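import Summits.MatrixMultiplication.MatrixMultiplication.Theorems.FarEdgeDescentWeightFamilyDet
import HarnessLib

/-!
# The BCZ line is degeneration-rigid, I: the algebra of the pair `(det X, det_q X)`

Route `FarEdgeDescent` (cell `decomp-mm`, lens 2 «structural dichotomy (special vs generic)»,
gen 37), Kernel XII; support for the aside `SubLogRate` (stmt-MatrixMultiplication-25371).

The `x`-pencil of the BCZ normal form `𝔖(q)` (`FarEdgeDescentWeightFamily.fam`) has determinant
`det X · det_q X`, `det_q X := x₀₀x₁₁ - q·x₀₁x₁₀` (`FarEdgeDescentLineRigidity.det_Tmat_fam`), its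
`y`-pencil `(u - v)(u - q v)`, `u = y₀₀y₁₁`, `v = y₀₁y₁₀` (`det_Smat_fam`).  A degeneration
`𝔖(q) ⊵ 𝔖(q')` gives `det X · det_{q'} X = c · P · Q` with `P`, `Q` the trailing `ε`-coefficients
of `u - v`, `u - q v` along series with linear coefficients.  This file turns that identity into
`q' ∈ {q, q⁻¹}`: `linear_mul_linear_ne_span` (**a product of two linear forms is never
`c_M·x₀₀x₁₁ + c_N·x₀₁x₁₀` with `c_M c_N ≠ 0`** — a scaling substitution reduces to the prime
`det X`), `pair_of_detX_mul_eq` (`{P, Q} = {κ₁ det X, κ₂ det_{q'} X}`), `order_data` (at the least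
`ε`-order of `u, v` the coefficients `a, b` satisfy `a - b = α det_{f₁} X`,
`a - q b = α' det_{f₂} X`, `(α, α') ≠ 0`, each of `a, b` being `0` or a product of linear forms,
whence
`(α - α')(α' f₂ - α f₁) = 0 = (qα - α')(α' f₂ - qα f₁)`; the field endgame is
`FarEdgeDescentLineRigidity.endgame`), `detXq_eq_C_mul_detX_imp` (source `q = 1`).  Every field.

References: M. Bläser, M. Christandl, J. Zuiddam, arXiv:1705.09652, §2, Lemma 3
[BlaserChristandlZuiddam2017]; P. Bürgisser, M. Clausen, M. A. Shokrollahi, *Algebraic Complexity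
Theory* (1997), §15.4, (15.19), §20.2 [BurgisserClausenShokrollahi1997].
-/

noncomputable section

open scoped BigOperators Polynomial

set_option linter.dupNamespace false

namespace Summit.MatrixMultiplication.MatrixMultiplication.Theorems.FarEdgeDescentLineDetPair

open Literature.Computability.AlgebraicComplexity
open Summit.MatrixMultiplication.MatrixMultiplication.Theorems.FarEdgeDescentSignTwistDet

universe u

/-! ## The twisted determinant `det_q X` -/

section DetXq
variable (K : Type u) [Field K]

/-- `det_q X := x₀₀x₁₁ - q·x₀₁x₁₀`, the determinant class of the `x`-pencil of `𝔖(q)`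
(`det_1 X = det X`, `det_0 X = x₀₀x₁₁`). [cite: BlaserChristandlZuiddam2017, §2] -/
def detXq (q : K) : Rx K :=
  MvPolynomial.X (0, 0) * MvPolynomial.X (1, 1) -
    MvPolynomial.C q * (MvPolynomial.X (0, 1) * MvPolynomial.X (1, 0))

/-- `det_1 X = det X`. [folklore] -/
theorem detXq_one : detXq K 1 = detX K := by
  rw [detXq, detX, map_one, one_mul]

/-- `det_q X` is a quadratic form. [folklore] -/
theorem detXq_isHomogeneous (q : K) : (detXq K q).IsHomogeneous 2 := by
  have hX := fun b : Fin 2 × Fin 2 => MvPolynomial.isHomogeneous_X K b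
  have hC : ((MvPolynomial.C q : Rx K) *
      (MvPolynomial.X (0, 1) * MvPolynomial.X (1, 0))).IsHomogeneous 2 := by
    simpa using (MvPolynomial.isHomogeneous_C (Fin 2 × Fin 2) q).mul ((hX (0, 1)).mul (hX (1, 0)))
  exact ((hX _).mul (hX _)).sub hC

/-- Evaluation of `det_q X`. [folklore] -/
theorem eval_detXq (q : K) (f : Fin 2 × Fin 2 → K) :
    MvPolynomial.eval f (detXq K q) = f (0, 0) * f (1, 1) - q * (f (0, 1) * f (1, 0)) := by
  simp [detXq]

/-- Evaluation of `det X`. [folklore] -/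
theorem eval_detX (f : Fin 2 × Fin 2 → K) :
    MvPolynomial.eval f (detX K) = f (0, 0) * f (1, 1) - f (0, 1) * f (1, 0) := by
  simp [detX]

/-- `det_q X ≠ 0` (its value at the identity matrix is `1`). [folklore] -/
theorem detXq_ne_zero (q : K) : detXq K q ≠ 0 := fun h => by
  have h1 :=
    congrArg (MvPolynomial.eval fun b : Fin 2 × Fin 2 => if b.1 = b.2 then (1 : K) else 0) h
  rw [eval_detXq, map_zero] at h1
  simp at h1

/-- `C κ · det_f X` in the monomial basis `x₀₀x₁₁`, `x₀₁x₁₀`. [folklore] -/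
theorem C_mul_detXq (κ f : K) : MvPolynomial.C κ * detXq K f =
    MvPolynomial.C κ * (MvPolynomial.X (0, 0) * MvPolynomial.X (1, 1)) +
      MvPolynomial.C (-(κ * f)) * (MvPolynomial.X (0, 1) * MvPolynomial.X (1, 0)) := by
  rw [detXq, map_neg, map_mul]
  ring

/-- **`det_{q'} X = w · det X` forces `q' = 1`** (values at `1₂` and at the transposition
matrix). [folklore] -/
theorem detXq_eq_C_mul_detX_imp {q' w : K} (h : detXq K q' = MvPolynomial.C w * detX K) :
    q' = 1 := by
  have h1 :=
    congrArg (MvPolynomial.eval fun b : Fin 2 × Fin 2 => if b.1 = b.2 then (1 : K) else 0) h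
  have h2 :=
    congrArg (MvPolynomial.eval fun b : Fin 2 × Fin 2 => if b.1 = b.2 then (0 : K) else 1) h
  rw [eval_detXq, map_mul, MvPolynomial.eval_C, eval_detX] at h1 h2
  simp at h1 h2
  exact h2.trans h1.symm

variable {K}

/-- **A product of two linear forms is never `c_M·x₀₀x₁₁ + c_N·x₀₁x₁₀` with `c_M c_N ≠ 0`**:
the substitution `x₀₁ ↦ -(c_M/c_N)·x₀₁` maps the right side to `c_M · det X`, a prime times a
unit, and linear forms to linear forms. [cite: BurgisserClausenShokrollahi1997, §15.4] -/
theorem linear_mul_linear_ne_span {l l' : Rx K} (hl : l.IsHomogeneous 1)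
    (hl' : l'.IsHomogeneous 1) {cM cN : K} (hM : cM ≠ 0) (hN : cN ≠ 0) :
    l * l' ≠ MvPolynomial.C cM * (MvPolynomial.X (0, 0) * MvPolynomial.X (1, 1)) +
      MvPolynomial.C cN * (MvPolynomial.X (0, 1) * MvPolynomial.X (1, 0)) := by
  intro h
  obtain ⟨g, hg₁, hg₂⟩ : ∃ g : Fin 2 × Fin 2 → Rx K,
      g (0, 1) = MvPolynomial.C (-(cM * cN⁻¹)) * MvPolynomial.X (0, 1) ∧
        ∀ b, b ≠ (0, 1) → g b = MvPolynomial.X b :=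
    ⟨fun b => if b = (0, 1) then MvPolynomial.C (-(cM * cN⁻¹)) * MvPolynomial.X b
      else MvPolynomial.X b, if_pos rfl, fun b hb => if_neg hb⟩
  have hg : ∀ b, (g b).IsHomogeneous 1 := by
    intro b
    by_cases hb : b = (0, 1)
    · rw [hb, hg₁]
      simpa using (MvPolynomial.isHomogeneous_C (Fin 2 × Fin 2) (-(cM * cN⁻¹))).mul
        (MvPolynomial.isHomogeneous_X K ((0 : Fin 2), (1 : Fin 2)))
    · rw [hg₂ b hb]
      exact MvPolynomial.isHomogeneous_X K b
  have hσl : (MvPolynomial.aeval g l).IsHomogeneous 1 := by simpa using hl.aeval g hg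
  have hσl' : (MvPolynomial.aeval g l').IsHomogeneous 1 := by simpa using hl'.aeval g hg
  have h' := congrArg (MvPolynomial.aeval g) h
  have hinv : MvPolynomial.C cN * MvPolynomial.C (-(cM * cN⁻¹)) = -(MvPolynomial.C cM : Rx K) := by
    rw [← map_mul, ← map_neg]
    congr 1
    field_simp
  have hσ : MvPolynomial.aeval g
      (MvPolynomial.C cM * (MvPolynomial.X (0, 0) * MvPolynomial.X (1, 1)) +
        MvPolynomial.C cN * (MvPolynomial.X (0, 1) * MvPolynomial.X (1, 0))) =
      MvPolynomial.C cM * detX K := by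
    simp only [map_add, map_mul, MvPolynomial.aeval_C, MvPolynomial.aeval_X,
      MvPolynomial.algebraMap_eq, hg₁, hg₂ (0, 0) (by decide), hg₂ (1, 1) (by decide),
      hg₂ (1, 0) (by decide), detX]
    linear_combination (MvPolynomial.X (0, 1) * MvPolynomial.X (1, 0) : Rx K) * hinv
  rw [map_mul, hσ] at h'
  exact linear_mul_linear_ne_C_mul_detX hσl hσl' hM h'

/-- Corollary: a product of two linear forms is never `κ · det_f X` with `κ f ≠ 0`.
[cite: BurgisserClausenShokrollahi1997, §15.4] -/
theorem linear_mul_linear_ne_C_mul_detXq {l l' : Rx K} (hl : l.IsHomogeneous 1)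
    (hl' : l'.IsHomogeneous 1) {κ f : K} (hκ : κ ≠ 0) (hf : f ≠ 0) :
    l * l' ≠ MvPolynomial.C κ * detXq K f := by
  rw [C_mul_detXq]
  exact linear_mul_linear_ne_span hl hl' hκ (neg_ne_zero.mpr (mul_ne_zero hκ hf))

/-- If `a` is `0` or a product of two linear forms and `a = c_M·x₀₀x₁₁ + c_N·x₀₁x₁₀`, then
`c_M c_N = 0`. [folklore] -/
theorem coeffs_mul_eq_zero {a : Rx K}
    (ha : a = 0 ∨ ∃ l l' : Rx K, l.IsHomogeneous 1 ∧ l'.IsHomogeneous 1 ∧ a = l * l')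
    {cM cN : K} (h : a = MvPolynomial.C cM * (MvPolynomial.X (0, 0) * MvPolynomial.X (1, 1)) +
      MvPolynomial.C cN * (MvPolynomial.X (0, 1) * MvPolynomial.X (1, 0))) : cM * cN = 0 := by
  by_contra hne
  obtain ⟨hM, hN⟩ := mul_ne_zero_iff.mp hne
  rcases ha with h0 | ⟨l, l', hl, hl', hll⟩
  · have h1 := congrArg
      (MvPolynomial.eval fun b : Fin 2 × Fin 2 => if b.1 = b.2 then (1 : K) else 0) h
    rw [h0, map_zero] at h1
    simp at h1
    exact hM h1.symm
  · exact linear_mul_linear_ne_span hl hl' hM hN (hll ▸ h)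

/-! ## Unique factorisation: `det X · F = c · P · Q` -/

/-- A non-zero quadratic form divisible by a non-zero quadratic form is a constant multiple of it.
[folklore] -/
theorem eq_C_mul_of_dvd {p P : Rx K} (hp : p.IsHomogeneous 2) (hp0 : p ≠ 0)
    (hP : P.IsHomogeneous 2) (hP0 : P ≠ 0) (h : p ∣ P) :
    ∃ κ : K, κ ≠ 0 ∧ P = MvPolynomial.C κ * p := by
  obtain ⟨r, hr⟩ := h
  have hr0 : r ≠ 0 := by
    rintro rfl
    exact hP0 (by rw [hr, mul_zero])
  have hdeg : r.totalDegree = 0 := by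
    have h1 := congrArg MvPolynomial.totalDegree hr
    rw [MvPolynomial.totalDegree_mul_of_isDomain hp0 hr0, hp.totalDegree hp0,
      hP.totalDegree hP0] at h1
    omega
  rw [MvPolynomial.totalDegree_eq_zero_iff_eq_C] at hdeg
  refine ⟨r.coeff 0, fun h0 => hr0 (by rw [hdeg, h0, map_zero]), ?_⟩
  rw [hr, mul_comm]
  congr 1

/-- **`det X · F = c · P · Q`** with `P, Q` quadratic forms and `F ≠ 0` forces
`{P, Q} = {κ₁ det X, κ₂ F}`. [folklore] -/
theorem pair_of_detX_mul_eq {w : K} {P Q F : Rx K} (hP : P.IsHomogeneous 2)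
    (hQ : Q.IsHomogeneous 2) (hF0 : F ≠ 0)
    (h : detX K * F = MvPolynomial.C w * P * Q) :
    ((∃ κ₁ : K, κ₁ ≠ 0 ∧ P = MvPolynomial.C κ₁ * detX K) ∧
        ∃ κ₂ : K, κ₂ ≠ 0 ∧ Q = MvPolynomial.C κ₂ * F) ∨
      ((∃ κ₁ : K, κ₁ ≠ 0 ∧ P = MvPolynomial.C κ₁ * F) ∧
        ∃ κ₂ : K, κ₂ ≠ 0 ∧ Q = MvPolynomial.C κ₂ * detX K) := by
  have h0 : detX K * F ≠ 0 := mul_ne_zero (detX_ne_zero K) hF0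
  have hw : w ≠ 0 := by
    rintro rfl
    rw [map_zero, zero_mul, zero_mul] at h
    exact h0 h
  have hP0 : P ≠ 0 := by
    rintro rfl
    rw [mul_zero, zero_mul] at h
    exact h0 h
  have hQ0 : Q ≠ 0 := by
    rintro rfl
    rw [mul_zero] at h
    exact h0 h
  have hunit : IsUnit (MvPolynomial.C w : Rx K) := (isUnit_iff_ne_zero.mpr hw).map MvPolynomial.C
  have hdvd : detX K ∣ P * Q := by
    have h1 : detX K ∣ MvPolynomial.C w * (P * Q) := ⟨F, by rw [← mul_assoc, ← h]⟩
    exact hunit.dvd_mul_left.mp h1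
  rcases (detX_prime K).dvd_or_dvd hdvd with h1 | h1
  · obtain ⟨κ₁, hκ₁, hP1⟩ := eq_C_mul_detX_of_dvd hP hP0 h1
    refine Or.inl ⟨⟨κ₁, hκ₁, hP1⟩, (w * κ₁)⁻¹, inv_ne_zero (mul_ne_zero hw hκ₁), ?_⟩
    have h2 : detX K * F = detX K * (MvPolynomial.C (w * κ₁) * Q) := by
      rw [h, hP1, map_mul]; ring
    have h3 := mul_left_cancel₀ (detX_ne_zero K) h2
    rw [h3, ← mul_assoc, ← map_mul, inv_mul_cancel₀ (mul_ne_zero hw hκ₁), map_one, one_mul]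
  · obtain ⟨κ₂, hκ₂, hQ1⟩ := eq_C_mul_detX_of_dvd hQ hQ0 h1
    refine Or.inr ⟨⟨(w * κ₂)⁻¹, inv_ne_zero (mul_ne_zero hw hκ₂), ?_⟩, κ₂, hκ₂, hQ1⟩
    have h2 : detX K * F = detX K * (MvPolynomial.C (w * κ₂) * P) := by
      rw [h, hQ1, map_mul]; ring
    have h3 := mul_left_cancel₀ (detX_ne_zero K) h2
    rw [h3, ← mul_assoc, ← map_mul, inv_mul_cancel₀ (mul_ne_zero hw hκ₂), map_one, one_mul]

/-! ## The least-order data of `(u - v, u - q v)` -/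

/-- If `p ≠ 0` vanishes below order `m₀` and its trailing coefficient is `κ · F`, then its
coefficient at `m₀` is a (possibly zero) constant multiple of `F`. [folklore] -/
theorem coeff_eq_C_mul_of_trailing {p : (Rx K)[X]} {m₀ : ℕ} (hp : p ≠ 0)
    (hlow : ∀ k < m₀, p.coeff k = 0) {κ : K} {F : Rx K}
    (htc : p.trailingCoeff = MvPolynomial.C κ * F) :
    ∃ α : K, p.coeff m₀ = MvPolynomial.C α * F := by
  have hle : m₀ ≤ p.natTrailingDegree := Polynomial.le_natTrailingDegree hp hlow
  rcases hle.eq_or_lt with h | h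
  · exact ⟨κ, by rw [h]; exact htc⟩
  · exact ⟨0, by rw [Polynomial.coeff_eq_zero_of_lt_natTrailingDegree h, map_zero, zero_mul]⟩

/-- A coefficient of a product of series with linear coefficients at an order `m₀ ≤ ord` is `0`
or a product of two linear forms. [folklore] -/
theorem coeff_zero_or_ll {y y' : (Rx K)[X]} (hy : ∀ k, (y.coeff k).IsHomogeneous 1)
    (hy' : ∀ k, (y'.coeff k).IsHomogeneous 1) {m₀ : ℕ} (hm : m₀ ≤ (y * y').natTrailingDegree) :
    (y * y').coeff m₀ = 0 ∨ ∃ l l' : Rx K, l.IsHomogeneous 1 ∧ l'.IsHomogeneous 1 ∧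
      (y * y').coeff m₀ = l * l' := by
  rcases hm.eq_or_lt with h | h
  · obtain ⟨l, l', hl, hl', hll⟩ := trailingCoeff_mul_isHomogeneous hy hy'
    exact Or.inr ⟨l, l', hl, hl', by rw [h, ← Polynomial.trailingCoeff, hll]⟩
  · exact Or.inl (Polynomial.coeff_eq_zero_of_lt_natTrailingDegree h)

/-- **The least-order data.**  If the `ε`-coefficients of the four series `y_b` are linear forms,
`q ≠ 1`, `f₁ ≠ 0`, and the trailing coefficients of `u - v`, `u - q v` (`u = y₀₀y₁₁`,
`v = y₀₁y₁₀`) are `κ₁ det_{f₁} X`, `κ₂ det_{f₂} X` (`κ₁κ₂ ≠ 0`), then some `(α, α') ≠ 0` has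
`(α - α')(α' f₂ - α f₁) = 0 = (qα - α')(α' f₂ - qα f₁)`.
[cite: BurgisserClausenShokrollahi1997, §15.4] -/
theorem order_data {q f₁ f₂ : K} (hq1 : q ≠ 1) (hf₁ : f₁ ≠ 0)
    (y : Fin 2 × Fin 2 → (Rx K)[X]) (HY : ∀ b k, ((y b).coeff k).IsHomogeneous 1)
    {κ₁ κ₂ : K} (hκ₁ : κ₁ ≠ 0) (hκ₂ : κ₂ ≠ 0)
    (h₁ : (y (0, 0) * y (1, 1) - y (0, 1) * y (1, 0)).trailingCoeff =
      MvPolynomial.C κ₁ * detXq K f₁)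
    (h₂ : (y (0, 0) * y (1, 1) -
        y (0, 1) * y (1, 0) * Polynomial.C (MvPolynomial.C q)).trailingCoeff =
      MvPolynomial.C κ₂ * detXq K f₂) :
    ∃ α α' : K, (α ≠ 0 ∨ α' ≠ 0) ∧ (α - α') * (α' * f₂ - α * f₁) = 0 ∧
      (q * α - α') * (α' * f₂ - q * α * f₁) = 0 := by
  set u := y (0, 0) * y (1, 1) with hu
  set v := y (0, 1) * y (1, 0) with hv
  have hC : ∀ {κ f : K}, κ ≠ 0 → MvPolynomial.C κ * detXq K f ≠ 0 := fun hκ =>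
    mul_ne_zero (by simpa using hκ) (detXq_ne_zero K _)
  -- the degenerate cases `v = 0`, `u = 0` contradict the hypotheses outright
  by_cases hv0 : v = 0
  · rw [hv0, sub_zero, Polynomial.trailingCoeff_mul] at h₁
    exact absurd h₁ (linear_mul_linear_ne_C_mul_detXq (HY _ _) (HY _ _) hκ₁ hf₁)
  by_cases hu0 : u = 0
  · have hneg : -v = (-y (0, 1)) * y (1, 0) := by rw [hv]; ring
    rw [hu0, zero_sub, hneg, Polynomial.trailingCoeff_mul] at h₁
    refine absurd h₁ (linear_mul_linear_ne_C_mul_detXq ?_ (HY (1, 0) _) hκ₁ hf₁)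
    rw [Polynomial.trailingCoeff, Polynomial.coeff_neg]
    exact (HY (0, 1) _).neg
  -- both non-zero: look at the least order `m₀`
  set Cq : (Rx K)[X] := Polynomial.C (MvPolynomial.C q) with hCq
  have hsub0 : u - v ≠ 0 := fun h => hC hκ₁ (by rw [← h₁, h, Polynomial.trailingCoeff_zero])
  have hsubq0 : u - v * Cq ≠ 0 := fun h =>
    hC hκ₂ (by rw [← h₂, h, Polynomial.trailingCoeff_zero])
  set m₀ := min u.natTrailingDegree v.natTrailingDegree with hm₀
  have hlowu : ∀ k < m₀, u.coeff k = 0 := fun k hk =>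
    Polynomial.coeff_eq_zero_of_lt_natTrailingDegree (lt_of_lt_of_le hk (min_le_left _ _))
  have hlowv : ∀ k < m₀, v.coeff k = 0 := fun k hk =>
    Polynomial.coeff_eq_zero_of_lt_natTrailingDegree (lt_of_lt_of_le hk (min_le_right _ _))
  obtain ⟨αm, hαm⟩ := coeff_eq_C_mul_of_trailing hsub0
    (fun k hk => by rw [Polynomial.coeff_sub, hlowu k hk, hlowv k hk, sub_zero]) h₁
  obtain ⟨αp, hαp⟩ := coeff_eq_C_mul_of_trailing hsubq0
    (fun k hk => by
      rw [Polynomial.coeff_sub, Polynomial.coeff_mul_C, hlowu k hk, hlowv k hk, zero_mul, sub_zero])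
    h₂
  rw [Polynomial.coeff_sub] at hαm
  rw [Polynomial.coeff_sub, Polynomial.coeff_mul_C] at hαp
  set a := u.coeff m₀ with ha
  set b := v.coeff m₀ with hb
  have E : MvPolynomial.C ((q - 1)⁻¹ : K) * (MvPolynomial.C q - 1 : Rx K) = 1 := by
    rw [← map_one (MvPolynomial.C (σ := Fin 2 × Fin 2) (R := K)), ← map_sub, ← map_mul,
      inv_mul_cancel₀ (sub_ne_zero.mpr hq1)]
  have hb₀ : b = MvPolynomial.C ((q - 1)⁻¹ : K) *
      (MvPolynomial.C αm * detXq K f₁ - MvPolynomial.C αp * detXq K f₂) := by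
    linear_combination (MvPolynomial.C ((q - 1)⁻¹ : K)) * hαm
      - (MvPolynomial.C ((q - 1)⁻¹ : K)) * hαp - b * E
  have ha₀ : a = b + MvPolynomial.C αm * detXq K f₁ := by linear_combination hαm
  -- the two coefficients in the basis `x₀₀x₁₁`, `x₀₁x₁₀`
  have hb' : b = MvPolynomial.C ((q - 1)⁻¹ * (αm - αp)) *
      (MvPolynomial.X (0, 0) * MvPolynomial.X (1, 1)) +
      MvPolynomial.C ((q - 1)⁻¹ * (αp * f₂ - αm * f₁)) *
        (MvPolynomial.X (0, 1) * MvPolynomial.X (1, 0)) := by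
    rw [hb₀, detXq, detXq]
    simp only [map_mul, map_sub]
    ring
  have ha' : a = MvPolynomial.C ((q - 1)⁻¹ * (αm - αp) + αm) *
      (MvPolynomial.X (0, 0) * MvPolynomial.X (1, 1)) +
      MvPolynomial.C ((q - 1)⁻¹ * (αp * f₂ - αm * f₁) - αm * f₁) *
        (MvPolynomial.X (0, 1) * MvPolynomial.X (1, 0)) := by
    rw [ha₀, hb₀, detXq, detXq]
    simp only [map_mul, map_sub, map_add]
    ring
  -- each of `a`, `b` is `0` or a product of two linear forms
  have hall : a = 0 ∨ ∃ l l' : Rx K, l.IsHomogeneous 1 ∧ l'.IsHomogeneous 1 ∧ a = l * l' :=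
    coeff_zero_or_ll (HY _) (HY _) (min_le_left _ _)
  have hbll : b = 0 ∨ ∃ l l' : Rx K, l.IsHomogeneous 1 ∧ l'.IsHomogeneous 1 ∧ b = l * l' :=
    coeff_zero_or_ll (HY _) (HY _) (min_le_right _ _)
  have hiq : ((q - 1)⁻¹ : K) ≠ 0 := inv_ne_zero (sub_ne_zero.mpr hq1)
  have C1 := coeffs_mul_eq_zero hbll hb'
  have C2 := coeffs_mul_eq_zero hall ha'
  refine ⟨αm, αp, ?_, ?_, ?_⟩
  · -- `(αm, αp) ≠ (0, 0)`: else `a = b = 0`, but one of `u, v` attains the order `m₀`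
    by_contra hne
    have hαm0 : αm = 0 := not_ne_iff.mp (not_or.mp hne).1
    have hαp0 : αp = 0 := not_ne_iff.mp (not_or.mp hne).2
    rw [hαm0, map_zero, zero_mul, sub_eq_zero] at hαm
    rw [hαp0, map_zero, zero_mul, sub_eq_zero] at hαp
    have hb0 : b = 0 := by
      have h3 : b * (MvPolynomial.C q - 1) = 0 := by linear_combination hαm - hαp
      refine (mul_eq_zero.mp h3).resolve_right fun h4 => hq1 ?_
      rw [← map_one (MvPolynomial.C (σ := Fin 2 × Fin 2) (R := K)), ← map_sub,
        MvPolynomial.C_eq_zero, sub_eq_zero] at h4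
      exact h4
    have ha0 : a = 0 := by rw [hαm, hb0]
    rcases min_choice u.natTrailingDegree v.natTrailingDegree with hm | hm
    · exact hu0 (Polynomial.trailingCoeff_eq_zero.mp
        (by rw [Polynomial.trailingCoeff, ← hm]; exact ha0))
    · exact hv0 (Polynomial.trailingCoeff_eq_zero.mp
        (by rw [Polynomial.trailingCoeff, ← hm]; exact hb0))
  · have h3 : ((q - 1)⁻¹ * (q - 1)⁻¹ : K) * ((αm - αp) * (αp * f₂ - αm * f₁)) = 0 := by
      linear_combination C1
    exact (mul_eq_zero.mp h3).resolve_left (mul_ne_zero hiq hiq)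
  · have h3 : ((q - 1)⁻¹ * (q - 1)⁻¹ : K) * ((q * αm - αp) * (αp * f₂ - q * αm * f₁)) = 0 := by
      have e1 : ((q - 1)⁻¹ * (αm - αp) + αm : K) = (q - 1)⁻¹ * (q * αm - αp) := by
        field_simp
        ring
      have e2 : ((q - 1)⁻¹ * (αp * f₂ - αm * f₁) - αm * f₁ : K) =
          (q - 1)⁻¹ * (αp * f₂ - q * αm * f₁) := by
        field_simp
        ring
      rw [e1, e2] at C2
      linear_combination C2
    exact (mul_eq_zero.mp h3).resolve_left (mul_ne_zero hiq hiq)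

end DetXq

end Summit.MatrixMultiplication.MatrixMultiplication.Theorems.FarEdgeDescentLineDetPair

end
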